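import Summits.NavierStokesRegularity.NavierStokesRegularity.Theorems.PlanarFluxAPriori.Negative.SlabApexBoundFalseKinematicLocal

/-!
# `stub_apexLocalBound` (line `local-far` of the piece `SlabApexBound`) is false in its kinematic form and from the
  initial time (apex foam, part 5; negative-side support for the crux `SlicedKelvin.PlanarFluxAPriori`,
  stmt-NavierStokesRegularity-15600, and its child piece stmt-NavierStokesRegularity-18181)

Refuter cdisprove seat g2, cycle 1 (2026-08-17). The crux strategist's skeleton `Cruxes/PlanarFluxAPriori/Lines/local_far.lean`
splits `stub_slabApexBound` at a radius: `stub_apexFarFieldTameness` (`∃ ρ`, far slab, every `ε`) and the load-bearing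
`stub_apexLocalBound` (`∀ t₀ ∈ Ioo 0 T, ∀ ρ > 0, ∃ M h > 0, ∀ t ∈ Ico t₀ T, ∀ R c,
liminf_{ε→0⁺} ∫⁻_{ {|⟪x,Re₂⟫−c|<h} ∩ B(0,ρ)} ofReal((ε²/√(f²+ε²)³)|Df[curl u(t)]|) ≤ M`). By part 4
(`ApexFoam.apexFoam_witness_local`: the apex functional of the foam is `⊤` on every set containing `B(0,2) ∩ {|x₂| < h}`), at
`ρ = 2`:

* `apexLocalBound_false_kinematic` — the local stub's conclusion for a general field `v` under the hypotheses of the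
  kinematic stubs of line `Sketch` (`ContDiff ℝ ⊤ v` + cubic decay of `Dᵏv`, `k ≤ 3`) is FALSE;
* `apexLocalBound_false_from_initialTime` — the registered `stub_apexLocalBound` with `t₀ ∈ Set.Ico 0 T` in place of
  `Set.Ioo 0 T` (everything else verbatim) is FALSE (tree's proved `local_classical_lerayHopf_holds` from the foam datum,
  `t = t₀ = 0`, `ρ = 2`, `R = 1`, `c = 0`).

So the radius split moves no difficulty: `t₀ > 0` and the Navier–Stokes structure of the slice are load-bearing in the LOCAL
stub exactly as in `stub_slabApexBound` (parts 3–4), and must enter quantitatively (a nodal / frequency bound for `ω(t)·n` in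
balls, uniform in `(t, R, c)`). The far stub is untouched by compactly supported foams (choose `ρ` beyond the support).
-/

noncomputable section

-- Problem = summit for this single-conjunct summit: the duplicate namespace component is deliberate.
set_option linter.dupNamespace false

namespace Summit.NavierStokesRegularity.NavierStokesRegularity.Theorems.PlanarFluxAPriori.Negative

open MeasureTheory Set Function Filter Topology Literature.Analysis.FluidPDE
open scoped ENNReal InnerProductSpace RealInnerProductSpace ContDiff

local notation "E3" => EuclideanSpace ℝ (Fin 3)

/-- `B(0,2) ∩ S ⊆ S ∩ B(0,2)`. -/
theorem ball_inter_subset_inter_ball (S : Set E3) :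
    Metric.ball (0 : E3) 2 ∩ S ⊆ S ∩ Metric.ball (0 : E3) 2 := fun _ hx => ⟨hx.2, hx.1⟩

/-- **`stub_apexLocalBound` is false in its kinematic form** (`ρ = 2`, `R = 1`, `c = 0`): smoothness and cubic decay of a
field do not bound the apex functional of `{|x₂| < h} ∩ B(0,2)` for any `h > 0`. [folklore] -/
theorem apexLocalBound_false_kinematic :
    ¬ (∀ (v : E3 → E3), ContDiff ℝ (⊤ : ℕ∞) v →
      (∃ C : ℝ, ∀ (x : E3) (k : ℕ), k ≤ 3 → (1 + ‖x‖) ^ 3 * ‖iteratedFDeriv ℝ k v x‖ ≤ C) →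
      ∀ (ρ : ℝ), 0 < ρ → ∃ M : NNReal, ∃ h : ℝ, 0 < h ∧ ∀ (R : E3 ≃ₗᵢ[ℝ] E3) (c : ℝ),
        Filter.liminf (fun ε : ℝ => ∫⁻ x in {x : E3 | |inner ℝ x (R (EuclideanSpace.single 2 1)) - c| < h}
            ∩ Metric.ball 0 ρ,
          ENNReal.ofReal (ε ^ 2 / Real.sqrt (inner ℝ (curl v x) (R (EuclideanSpace.single 2 1)) ^ 2
            + ε ^ 2) ^ 3 *
            |fderiv ℝ (fun z => inner ℝ (curl v z) (R (EuclideanSpace.single 2 1))) x (curl v x)|))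
          (nhdsWithin 0 (Set.Ioi 0)) ≤ (M : ENNReal)) := by
  intro H
  obtain ⟨v, hv, -, -, -, hdec, htop⟩ := ApexFoam.apexFoam_witness_local
  obtain ⟨M, h, hh, hM⟩ := H v hv hdec 2 two_pos
  have h1 := hM (LinearIsometryEquiv.refl ℝ _) 0
  rw [htop h hh _ (ball_inter_subset_inter_ball _)] at h1
  exact ENNReal.coe_ne_top (top_le_iff.1 h1)

/-- **`t₀ > 0` is load-bearing in `stub_apexLocalBound`.** The registered stub of line `local-far` with the base time
allowed to be the initial time (`t₀ ∈ Set.Ico 0 T` in place of `Set.Ioo 0 T`, everything else verbatim) is FALSE: run the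
tree's local classical Leray–Hopf existence theorem from the apex-foam datum and evaluate at `t = t₀ = 0`, `ρ = 2`.
[folklore] -/
theorem apexLocalBound_false_from_initialTime :
    ¬ (∀ (ν T : ℝ), 0 < ν → 0 < T → ∀ (u : ℝ → E3 → E3) (p : ℝ → E3 → ℝ),
      IsClassicalNSSolutionOn (Set.Ico 0 T) ν 0 u p → IsLerayHopfOn T ν 0 (u 0) u →
      HasRapidSpatialDecay (u 0) →
      ∀ t₀ ∈ Set.Ico 0 T, ∀ (ρ : ℝ), 0 < ρ → ∃ M : NNReal, ∃ h : ℝ, 0 < h ∧ ∀ t ∈ Set.Ico t₀ T,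
        ∀ (R : E3 ≃ₗᵢ[ℝ] E3) (c : ℝ),
        Filter.liminf (fun ε : ℝ => ∫⁻ x in {x : E3 | |inner ℝ x (R (EuclideanSpace.single 2 1)) - c| < h}
            ∩ Metric.ball 0 ρ,
          ENNReal.ofReal (ε ^ 2 / Real.sqrt (inner ℝ (curl (u t) x) (R (EuclideanSpace.single 2 1)) ^ 2
            + ε ^ 2) ^ 3 *
            |fderiv ℝ (fun z => inner ℝ (curl (u t) z) (R (EuclideanSpace.single 2 1))) x (curl (u t) x)|))
          (nhdsWithin 0 (Set.Ioi 0)) ≤ (M : ENNReal)) := by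
  intro H
  obtain ⟨v, hv, -, hdiv, hdecay, -, htop⟩ := ApexFoam.apexFoam_witness_local
  obtain ⟨T, hT, u, p, hcl, hu0, hLH⟩ := local_classical_lerayHopf_holds 1 one_pos v hv hdiv hdecay
  rw [← hu0] at hLH hdecay
  obtain ⟨M, h, hh, hM⟩ := H 1 T one_pos hT u p hcl hLH hdecay 0 ⟨le_rfl, hT⟩ 2 two_pos
  have h1 := hM 0 ⟨le_rfl, hT⟩ (LinearIsometryEquiv.refl ℝ _) 0
  rw [hu0, htop h hh _ (ball_inter_subset_inter_ball _)] at h1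
  exact ENNReal.coe_ne_top (top_le_iff.1 h1)

end Summit.NavierStokesRegularity.NavierStokesRegularity.Theorems.PlanarFluxAPriori.Negative

end
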